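import Summits.Ventures.LatticeQCDFlow.Scoring.UNHaarTraceMomentsTableaux
import Summits.Ventures.LatticeQCDFlow.Scoring.SUNBaryonVertex
import Summits.Ventures.LatticeQCDFlow.Scoring.SUNOnePlaquetteHaarMGF
import HarnessLib

/-!
# The strong-coupling expansion of the 2-d `SU(N)` one-plaquette law: Gaussian below order `N`, and the baryon term `2(x/2)^N/N!` at order `N`

HONEST FRAMING: exact (Metropolis-corrected) sampling algorithms for lattice gauge theory;
figures of merit are autocorrelation/cost numbers at stated couplings and volumes; no
continuum-physics claim.

Venture `LatticeQCDFlow` (cell pub-lqcd), sub-topic `Scoring`; FANOUT row 5 (`s0-sun-a`), GEN-23.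
NEW WORK of the cell (placement rule).  Row 5's `SU(N)` one-plaquette partition function for every `N` is the
Bars–Green series `Z^{SU}_N(x) = ∫_{SU(N)} e^{x Re tr V} dV = Σ_{q∈ℤ} det[I_{|q+i−j|}(x)]_{N×N}`
(`SUNOnePlaquetteBesselSeries`; as a moment generating function, `SUNOnePlaquetteHaarMGF`).  With the `SU(N)` trace
moments of `SUNBaryonVertex` and the `U(N)` Taylor data of `UNHaarTraceMomentsTableaux`:

* `iteratedDeriv_tsum_det_besselI_zero`: `(Z^{SU}_N)^{(k)}(0) = ∫_{SU(N)} (Re tr V)^k dV` (Mathlib's `iteratedDeriv_mgf_zero`);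
* **`iteratedDeriv_tsum_det_besselI_zero_of_lt`: for `k < N`, `(Z^{SU}_N)^{(k)}(0) = (Z^{U}_N)^{(k)}(0)`** — the `SU(N)`
  and `U(N)` one-plaquette laws have the same Taylor coefficients below order `N`, namely the Gaussian ones
  (`…_even_of_lt`: `(2m)!/(4^m m!)` for `k = 2m < N`; `…_odd_of_lt`: `0`);
* **`iteratedDeriv_tsum_det_besselI_zero_card`: `(Z^{SU}_N)^{(N)}(0) = (Z^{U}_N)^{(N)}(0) + 2^{1−N}`** (`N ≥ 1`) — THE
  BARYON TERM: `Z^{SU}_N(x) − Z^{U}_N(x) = 2 (x/2)^N / N! + O(x^{N+1})`; e.g. `SU(3)`: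
  `Σ_q det[I_{|q+i−j|}(x)]_{3×3} = 1 + x²/4 + x³/24 + O(x⁴)`.

No `def`, no named fact, 0 sorry.
-/

noncomputable section

open Real MeasureTheory Finset Complex ProbabilityTheory
open scoped ComplexConjugate
open Literature.MathematicalPhysics.QuantumFieldTheory (haarProbability)
open Literature.Analysis.FunctionSpaces

namespace Summit.Ventures.LatticeQCDFlow.Scoring

variable {N : ℕ}

/-- **THE TAYLOR COEFFICIENTS OF THE BARS–GREEN SERIES AT `0` ARE THE MOMENTS OF `Re tr V` ON `SU(N)`.** -/
theorem iteratedDeriv_tsum_det_besselI_zero (N : ℕ) [NeZero N] (k : ℕ) :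
    iteratedDeriv k (fun x : ℝ => ∑' q : ℤ, (Matrix.of fun i j : Fin N => besselI (q + (i : ℤ) - (j : ℤ)).natAbs x).det) 0
      = ∫ V, ((((V : Matrix.specialUnitaryGroup (Fin N) ℂ) : Matrix (Fin N) (Fin N) ℂ).trace).re) ^ k
          ∂(haarProbability (Matrix.specialUnitaryGroup (Fin N) ℂ)) := by
  rw [show (fun x : ℝ => ∑' q : ℤ, (Matrix.of fun i j : Fin N => besselI (q + (i : ℤ) - (j : ℤ)).natAbs x).det)
      = mgf (fun u : Matrix.specialUnitaryGroup (Fin N) ℂ =>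
          ((u : Matrix.specialUnitaryGroup (Fin N) ℂ) : Matrix (Fin N) (Fin N) ℂ).trace.re)
          (haarProbability (Matrix.specialUnitaryGroup (Fin N) ℂ)) from
    funext fun x => (mgf_trace_re_specialUnitaryGroup N x).symm,
    iteratedDeriv_mgf_zero (mem_interior_integrableExpSet_of_abs_le_const
      (aestronglyMeasurable_trace_re_specialUnitaryGroup N) (fun u => abs_trace_re_le_card_su u) 0)]
  rfl

/-- **BELOW ORDER `N` THE `SU(N)` AND `U(N)` ONE-PLAQUETTE LAWS AGREE**: for `k < N`,
`(Σ_q det[I_{|q+i−j|}])^{(k)}(0) = (det[I_{|i−j|}])^{(k)}(0)`. -/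
theorem iteratedDeriv_tsum_det_besselI_zero_of_lt {N k : ℕ} [NeZero N] (hk : k < N) :
    iteratedDeriv k (fun x : ℝ => ∑' q : ℤ, (Matrix.of fun i j : Fin N => besselI (q + (i : ℤ) - (j : ℤ)).natAbs x).det) 0
      = iteratedDeriv k (fun x : ℝ => (Matrix.of fun i j : Fin N => besselI ((i : ℤ) - (j : ℤ)).natAbs x).det) 0 := by
  rw [iteratedDeriv_tsum_det_besselI_zero, iteratedDeriv_det_besselI_toeplitz_zero,
    integral_re_trace_pow_specialUnitary_of_lt hk]

/-- For even `k = 2m < N`: `(Z^{SU}_N)^{(2m)}(0) = (2m)!/(4^m m!)` (the Gaussian value). -/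
theorem iteratedDeriv_tsum_det_besselI_zero_even_of_lt {N m : ℕ} [NeZero N] (hm : 2 * m < N) :
    iteratedDeriv (2 * m) (fun x : ℝ => ∑' q : ℤ,
        (Matrix.of fun i j : Fin N => besselI (q + (i : ℤ) - (j : ℤ)).natAbs x).det) 0
      = ((2 * m).factorial : ℝ) / (4 ^ m * m.factorial) := by
  rw [iteratedDeriv_tsum_det_besselI_zero_of_lt hm, iteratedDeriv_det_besselI_toeplitz_zero_even (by omega)]

/-- For odd `k = 2m + 1 < N`: `(Z^{SU}_N)^{(2m+1)}(0) = 0`. -/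
theorem iteratedDeriv_tsum_det_besselI_zero_odd_of_lt {N m : ℕ} [NeZero N] (hm : 2 * m + 1 < N) :
    iteratedDeriv (2 * m + 1) (fun x : ℝ => ∑' q : ℤ,
        (Matrix.of fun i j : Fin N => besselI (q + (i : ℤ) - (j : ℤ)).natAbs x).det) 0 = 0 := by
  rw [iteratedDeriv_tsum_det_besselI_zero_of_lt hm, iteratedDeriv_det_besselI_toeplitz_zero_odd]

/-- **THE BARYON TERM**: at order `N ≥ 1` the `SU(N)` one-plaquette partition function exceeds the `U(N)` one by
`2^{1−N} · x^N/N! = 2(x/2)^N/N!`: `(Σ_q det[I_{|q+i−j|}])^{(N)}(0) = (det[I_{|i−j|}])^{(N)}(0) + 2^{1−N}` — the two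
baryon vertices `∫_{SU(N)} (tr V)^N = ∫_{SU(N)} (conj tr V)^N = 1` in the binomial expansion of `(Re tr V)^N`. -/
theorem iteratedDeriv_tsum_det_besselI_zero_card (N : ℕ) [NeZero N] :
    iteratedDeriv N (fun x : ℝ => ∑' q : ℤ, (Matrix.of fun i j : Fin N => besselI (q + (i : ℤ) - (j : ℤ)).natAbs x).det) 0
      = iteratedDeriv N (fun x : ℝ => (Matrix.of fun i j : Fin N => besselI ((i : ℤ) - (j : ℤ)).natAbs x).det) 0
          + 2 * (2 : ℝ)⁻¹ ^ N := by
  have hN : 0 < N := Nat.pos_of_ne_zero (NeZero.ne N)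
  rw [iteratedDeriv_tsum_det_besselI_zero, iteratedDeriv_det_besselI_toeplitz_zero,
    integral_re_trace_pow_card_specialUnitary hN]
  rcases Nat.even_or_odd N with ⟨m, hm⟩ | ⟨m, hm⟩
  · rw [← two_mul] at hm
    subst hm
    rw [integral_re_trace_pow_even, Finset.sum_filter, Finset.sum_eq_single m (fun i _ him => if_neg (by omega))
      (fun h => absurd (mem_range.mpr (by omega)) h), if_pos rfl, integral_haar_specialUnitaryGroup_norm_trace_pow_eq,
      show ((2 : ℝ)⁻¹) ^ (2 * m) = 1 / 4 ^ m by rw [pow_mul, one_div, ← inv_pow]; norm_num]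
    ring
  · subst hm
    rw [integral_re_trace_pow_odd, Finset.sum_filter, Finset.sum_eq_zero (fun i _ => if_neg (by omega))]
    ring

end Summit.Ventures.LatticeQCDFlow.Scoring
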